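import Summits.HodgeConjecture.CorCM.GaloisSixteenSplitTimesCyclicDegenerate
import Summits.HodgeConjecture.CorCM.GaloisTwoHalvesCyclicFibres
import HarnessLib

/-!
# Pauli `× C_n` and `(C₄ × C₂) ⋊ C₂ × C_n` are BAD for EVERY `n ≥ 3` (two halves over cyclic fibres)

COR-CM (cell `pub-hodgecm2`), binder seat b04 (gen 29), count-neutral own lane «Galois-CM-type classification».  KERNEL ONLY:
theorems; no definition, no named fact, no `sorry`.  `HC_CM` is neither used nor claimed.

`CorCM/GaloisSixteenSplitTimesCyclicDegenerate` proved the instances `n = 3, 5` by `decide` on the whole of `(ℤ/4 × ℤ/2) × ℤ/n`.  With the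
fibre lemmas of `CorCM/GaloisTwoHalvesCyclicFibres` (`fibre_cm`, `fibre_aperiodic`, `fibre_asymmetric`) the half is assembled from TWO CM
halves `H₁ ≠ H₂` of `B = ℤ/4 × ℤ/2` (fibre `H₂` over `v = 1`, `H₁` elsewhere) and only finite facts INSIDE `B` remain (`decide`, 8
elements): no `a ≠ 0` stabilises both, no `a` has `a + θH₁ = H₁` and `a + θH₂ = H₂`.  Hence, for every `n ≥ 3` and complex conjugation
`(c₀, 1)`: **`(C₄ ∘ D₄) × C_n` is BAD** (`c₀ = (2,0)`; Pauli alone is GOOD) and **`((C₄ × C₂) ⋊ C₂) × C_n` is BAD for each of its three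
central involutions** — simple DEGENERATE CM abelian varieties of dimension `8n` with an exceptional Hodge class on a power.  Pairs of
halves from `scratch-g29/twohalves.py` (192 / 128 / 192 / 128 admissible pairs respectively).

## References

* [Kubota1965] T. Kubota, *On the field extension by complex multiplication*, Trans. AMS 118 (1965), §2, §4 Lemma 2.
* [Shimura1998] G. Shimura, *Abelian Varieties with Complex Multiplication and Modular Functions*, §6.2 Thm. 3, §8.2 Prop. 26.
* [Gordon1999HodgeAVSurvey] B. B. Gordon, *A survey of the Hodge conjecture for abelian varieties*, Thm. 6.4, §9.3.
-/

noncomputable section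

open CategoryTheory CategoryTheory.Limits NumberField
open scoped BigOperators

namespace Summit.HodgeConjecture.CorCM.SplitInvolution

open Literature.NumberTheory.ComplexMultiplication
open Literature.AlgebraicGeometry.Motives (AbelianVariety CMType)
open Literature.AlgebraicGeometry.HodgeTheory
open Literature.AlgebraicGeometry.ComplexMultiplication (IsCMTypeRealisation)
open Literature.AlgebraicGeometry.Pohlmann1968
open Literature.Barriers.HodgeConjecture (divisorClassesSpan)
open Summit.HodgeConjecture.CorCM.TwoHalves

variable {K : Type} [Field K] [NumberField K] [IsCMField K] [IsGalois ℚ K]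

/-- **Pauli `(C₄ ∘ D₄) × C_n`, complex conjugation `((2,0), 1)`, is BAD for every `n ≥ 3`** (two-halves fibre half
`H₁ = {(0,0),(0,1),(1,0),(1,1)}`, `H₂ = {(1,1),(2,0),(2,1),(3,0)}` over `v = 1`).
[cite: Kubota1965, §2 and §4 Lemma 2] [cite: Shimura1998, §6.2 Thm. 3 and §8.2 Prop. 26] [cite: Gordon1999HodgeAVSurvey, Thm. 6.4 and §9.3] -/
theorem exists_simple_degenerate_pauli_times_cyclic {n : ℕ} [NeZero n] (hn : 3 ≤ n)
    (φ : Multiplicative (ZMod 2) →* MulAut (Multiplicative (ZMod 4 × ZMod 2)))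
    (hφ : ∀ w, Multiplicative.toAdd (φ (Multiplicative.ofAdd 1) w) =
      ((Multiplicative.toAdd w).1 + 2 * ((Multiplicative.toAdd w).2.val : ZMod 4), (Multiplicative.toAdd w).2))
    (e : (K ≃ₐ[ℚ] K) ≃* (Multiplicative (ZMod 4 × ZMod 2) ⋊[φ] Multiplicative (ZMod 2)) × Multiplicative (ZMod n))
    (hc : e ((IsCMField.complexConj K).restrictScalars ℚ) = (SemidirectProduct.inl (Multiplicative.ofAdd (2, 0)), 1)) :
    ∃ (Φ : CMType K) (φ₀ : K →+* ℂ) (X : AbelianVariety ℂ) (ι : 𝓞 K →+* End X)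
      (ϑ : K →+* Module.End ℂ (complexBetti X.X 1)),
      IsPrimitive (ℂ ≃+* ℂ) Φ.1 φ₀ ∧ ¬ IsNondegenerate Φ ∧ IsCMTypeRealisation Φ X ι ϑ ∧ X.IsSimple ∧ X.dim = 8 * n ∧
      ∃ m q : ℕ, ∃ y : complexBetti (⨁ fun _ : Fin m => X).X (2 * q), IsRationalClass y ∧
        IsOfHodgeType (⨁ fun _ : Fin m => X).dim (⨁ fun _ : Fin m => X).X (2 * q) q q y ∧
        y ∉ divisorClassesSpan (⨁ fun _ : Fin m => X).X (⨁ fun _ : Fin m => X).dim q := by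
  classical
  exact exists_simple_degenerate_fourTwo_semidirect_times_cyclic_of_half (fun w => (w.1 + 2 * (w.2.val : ZMod 4), w.2)) φ hφ
    (2, 0) (by decide) (by decide) (by decide) e hc
    (fun s => if s.2 = 1 then s.1 ∈ ({(1,1), (2,0), (2,1), (3,0)} : Finset (ZMod 4 × ZMod 2))
      else s.1 ∈ ({(0,0), (0,1), (1,0), (1,1)} : Finset (ZMod 4 × ZMod 2)))
    (fibre_cm _ _ (2, 0) (by decide) (by decide))
    (fibre_aperiodic hn _ _ (by decide) (by decide))
    (fibre_asymmetric hn (fun w : ZMod 4 × ZMod 2 => (w.1 + 2 * (w.2.val : ZMod 4), w.2)) (by decide) _ _ (by decide) (by decide))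

/-- **`((C₄ × C₂) ⋊ C₂) × C_n` (SmallGroup(16,3) times `C_n`) is BAD for every `n ≥ 3` and EACH central involution
`c₀ ∈ {(2,0), (0,1), (2,1)}`** (two-halves fibre halves, one pair per `c₀`).
[cite: Kubota1965, §2 and §4 Lemma 2] [cite: Shimura1998, §6.2 Thm. 3 and §8.2 Prop. 26] [cite: Gordon1999HodgeAVSurvey, Thm. 6.4 and §9.3] -/
theorem exists_simple_degenerate_fourTwoSemidirect_times_cyclic {n : ℕ} [NeZero n] (hn : 3 ≤ n)
    (φ : Multiplicative (ZMod 2) →* MulAut (Multiplicative (ZMod 4 × ZMod 2)))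
    (hφ : ∀ w, Multiplicative.toAdd (φ (Multiplicative.ofAdd 1) w) =
      ((Multiplicative.toAdd w).1, (Multiplicative.toAdd w).2 + ((Multiplicative.toAdd w).1.val : ZMod 2)))
    (c₀ : ZMod 4 × ZMod 2) (hc₀ : c₀ = (2, 0) ∨ c₀ = (0, 1) ∨ c₀ = (2, 1))
    (e : (K ≃ₐ[ℚ] K) ≃* (Multiplicative (ZMod 4 × ZMod 2) ⋊[φ] Multiplicative (ZMod 2)) × Multiplicative (ZMod n))
    (hc : e ((IsCMField.complexConj K).restrictScalars ℚ) = (SemidirectProduct.inl (Multiplicative.ofAdd c₀), 1)) :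
    ∃ (Φ : CMType K) (φ₀ : K →+* ℂ) (X : AbelianVariety ℂ) (ι : 𝓞 K →+* End X)
      (ϑ : K →+* Module.End ℂ (complexBetti X.X 1)),
      IsPrimitive (ℂ ≃+* ℂ) Φ.1 φ₀ ∧ ¬ IsNondegenerate Φ ∧ IsCMTypeRealisation Φ X ι ϑ ∧ X.IsSimple ∧ X.dim = 8 * n ∧
      ∃ m q : ℕ, ∃ y : complexBetti (⨁ fun _ : Fin m => X).X (2 * q), IsRationalClass y ∧
        IsOfHodgeType (⨁ fun _ : Fin m => X).dim (⨁ fun _ : Fin m => X).X (2 * q) q q y ∧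
        y ∉ divisorClassesSpan (⨁ fun _ : Fin m => X).X (⨁ fun _ : Fin m => X).dim q := by
  classical
  rcases hc₀ with rfl | rfl | rfl
  · exact exists_simple_degenerate_fourTwo_semidirect_times_cyclic_of_half (fun w => (w.1, w.2 + (w.1.val : ZMod 2))) φ hφ
      (2, 0) (by decide) (by decide) (by decide) e hc
      (fun s => if s.2 = 1 then s.1 ∈ ({(0,1), (1,1), (2,0), (3,0)} : Finset (ZMod 4 × ZMod 2))
        else s.1 ∈ ({(0,0), (0,1), (1,0), (1,1)} : Finset (ZMod 4 × ZMod 2)))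
      (fibre_cm _ _ (2, 0) (by decide) (by decide))
      (fibre_aperiodic hn _ _ (by decide) (by decide))
      (fibre_asymmetric hn (fun w : ZMod 4 × ZMod 2 => (w.1, w.2 + (w.1.val : ZMod 2))) (by decide) _ _ (by decide) (by decide))
  · exact exists_simple_degenerate_fourTwo_semidirect_times_cyclic_of_half (fun w => (w.1, w.2 + (w.1.val : ZMod 2))) φ hφ
      (0, 1) (by decide) (by decide) (by decide) e hc
      (fun s => if s.2 = 1 then s.1 ∈ ({(0,1), (1,1), (2,1), (3,0)} : Finset (ZMod 4 × ZMod 2))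
        else s.1 ∈ ({(0,1), (1,1), (2,1), (3,1)} : Finset (ZMod 4 × ZMod 2)))
      (fibre_cm _ _ (0, 1) (by decide) (by decide))
      (fibre_aperiodic hn _ _ (by decide) (by decide))
      (fibre_asymmetric hn (fun w : ZMod 4 × ZMod 2 => (w.1, w.2 + (w.1.val : ZMod 2))) (by decide) _ _ (by decide) (by decide))
  · exact exists_simple_degenerate_fourTwo_semidirect_times_cyclic_of_half (fun w => (w.1, w.2 + (w.1.val : ZMod 2))) φ hφ
      (2, 1) (by decide) (by decide) (by decide) e hc
      (fun s => if s.2 = 1 then s.1 ∈ ({(0,1), (1,1), (2,1), (3,1)} : Finset (ZMod 4 × ZMod 2))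
        else s.1 ∈ ({(0,0), (0,1), (1,0), (1,1)} : Finset (ZMod 4 × ZMod 2)))
      (fibre_cm _ _ (2, 1) (by decide) (by decide))
      (fibre_aperiodic hn _ _ (by decide) (by decide))
      (fibre_asymmetric hn (fun w : ZMod 4 × ZMod 2 => (w.1, w.2 + (w.1.val : ZMod 2))) (by decide) _ _ (by decide) (by decide))

end Summit.HodgeConjecture.CorCM.SplitInvolution

end
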